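import Summits.HubbardSuperconductivity.HubbardSuperconductivity.Theorems.WeakCouplingBCSKlStairCore

/-!
# KL-MARGIN-SCAN reader hubbard-klscan-idea-4, round 9 — order-ideal staircase certificates, part 2/5 (§4–§6: staircase soundness, doping corollaries)

INNER soundness (`istair_spec`, `IStair.filling_ge`, `IStair.le_filling`: a checked inscribed staircase is a union of symmetric boxes inside the
sea, so `2·area/π² ≤ n[ε_{t′}](μ)`), OUTER soundness (`ocover_spec`, `OStair.filling_le`, `OStair.filling_lt`: the sea lies in the circumscribed
staircase), and the two order lemmas turning certified fillings into bounds on `μ(δ; t′) = klMuOfDopingTP t′ δ` (`muOfDoping_le_of_le_filling`,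
`le_muOfDoping_of_filling_lt`). Thesis, lever and references: see part 1 `WeakCouplingBCSKlStairCore`.

HONEST FRAMING. Free-band filling geometry of `squareDispersion 1 t′` only; floats quoted in docstrings are floats; nothing here asserts a KL
margin at `t′ ≠ 0`, `K₃`, the window or superconductivity; a Kohn–Luttinger `O(U²)` channel statement is not ODLRO; nothing proves superconductivity
in the Hubbard model; no `t′ ≠ 0` statement chains to the summit Statement. 0 kit · 0 sorry.
-/

noncomputable section

-- the tree's namespace `Summit.<Summit>.<Problem>.Theorems` repeats the summit name by design (D-0017); same line as in the
-- landed siblings `KLProgrammeMuOfDopingWindowFillingD005Lower` / `WeakCouplingBCSKlIsoDensityLevelMotion`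
set_option linter.dupNamespace false

namespace Summit.HubbardSuperconductivity.HubbardSuperconductivity.Theorems.KlStair

open Real Set MeasureTheory Literature.MathematicalPhysics.QuantumLattice
open Summit.HubbardSuperconductivity.HubbardSuperconductivity.Theorems
open Summit.HubbardSuperconductivity.HubbardSuperconductivity.Theorems.FSPoly (cosLoQ cosUpQ piLoQ cosLoQ_le_cos cos_le_cosUpQ)
open Summit.HubbardSuperconductivity.HubbardSuperconductivity.Theorems.KlLevelMotion

/-! ### §4  INNER soundness: the staircase lies in the sea; `2·area/π² ≤ n` -/

/-- The INNER staircase from abscissa `xp` on, as a set. [folklore] -/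
def istairSet : ℚ → List (ℚ × ℚ) → Set (ℝ × ℝ)
  | _, [] => ∅
  | xp, c :: rest => absBox (xp : ℝ) (c.1 : ℝ) (c.2 : ℝ) ∪ istairSet c.1 rest

/-- An inscribed staircase passing `ichain` lies inside `seaCoord`, is measurable, and has volume `4·iarea` (induction on the chain). [folklore] -/
theorem istair_spec {tp mu : ℚ} (htp : |(tp : ℝ)| ≤ 1 / 2) :
    ∀ (rest : List (ℚ × ℚ)) (xp : ℚ), (0 : ℚ) ≤ xp → ichain tp mu xp rest = true →
      istairSet xp rest ⊆ seaCoord tp mu ∧ MeasurableSet (istairSet xp rest) ∧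
        istairSet xp rest ⊆ {q : ℝ × ℝ | ((xp : ℚ) : ℝ) ≤ |q.1|} ∧
        volume (istairSet xp rest) = ENNReal.ofReal (4 * ((iarea xp rest : ℚ) : ℝ)) ∧ (0 : ℚ) ≤ iarea xp rest := by
  intro rest
  induction rest with
  | nil => intro xp _ _; simp [istairSet, iarea]
  | cons c rest ih =>
    intro xp hxp h
    simp only [ichain, Bool.and_eq_true, decide_eq_true_eq] at h
    obtain ⟨⟨hxc, hc⟩, hrest⟩ := h
    obtain ⟨hy0, hxπ, hyπ, hband⟩ := icorner_sound htp hc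
    have hc0 : (0 : ℚ) ≤ c.1 := le_trans hxp hxc
    obtain ⟨hR, hM, hS, hV, hA⟩ := ih c.1 hc0 hrest
    have hxc' : ((xp : ℚ) : ℝ) ≤ ((c.1 : ℚ) : ℝ) := by exact_mod_cast hxc
    have hxp' : (0 : ℝ) ≤ ((xp : ℚ) : ℝ) := by exact_mod_cast hxp
    -- the new box lies in the sea
    have hB : absBox (xp : ℝ) (c.1 : ℝ) (c.2 : ℝ) ⊆ seaCoord tp mu := by
      intro q hq
      obtain ⟨h1, h2, h3⟩ := mem_absBox.1 hq
      have a1 := abs_lt.1 (lt_trans h2 hxπ)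
      have a2 := abs_lt.1 (lt_trans h3 hyπ)
      refine ⟨⟨a1.1.le, a1.2⟩, ⟨a2.1.le, a2.2⟩, ?_⟩
      show bandR tp (cos q.1) (cos q.2) < mu
      rw [← Real.cos_abs q.1, ← Real.cos_abs q.2]
      exact lt_of_le_of_lt (bandR_cos_mono htp (abs_nonneg _) h2.le hxπ.le (abs_nonneg _) h3.le hyπ.le) hband
    have hBm := measurableSet_absBox (xp : ℝ) (c.1 : ℝ) (c.2 : ℝ)
    have hBv := volume_absBox (y := ((c.2 : ℚ) : ℝ)) hxp' hxc'
    refine ⟨union_subset hB hR, hBm.union hM, ?_, ?_, ?_⟩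
    · rintro q (hq | hq)
      · exact (mem_absBox.1 hq).1
      · have := hS hq
        simp only [mem_setOf_eq] at this ⊢
        linarith
    · have hdisj : Disjoint (absBox (xp : ℝ) (c.1 : ℝ) (c.2 : ℝ)) (istairSet c.1 rest) := by
        rw [Set.disjoint_left]
        intro q hq1 hq2
        have h1 : |q.1| < (c.1 : ℝ) := (mem_absBox.1 hq1).2.1
        have h2 : ((c.1 : ℚ) : ℝ) ≤ |q.1| := hS hq2
        linarith
      show volume (absBox (xp : ℝ) (c.1 : ℝ) (c.2 : ℝ) ∪ istairSet c.1 rest) =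
        ENNReal.ofReal (4 * ((((c.1 - xp) * c.2 + iarea c.1 rest : ℚ)) : ℝ))
      rw [measure_union hdisj hM, hBv, hV]
      have ha : (0 : ℝ) ≤ 4 * ((((c.1 : ℚ) : ℝ) - xp) * c.2) := by
        have : (0 : ℝ) ≤ (((c.1 : ℚ) : ℝ) - xp) := by linarith
        positivity
      have hb : (0 : ℝ) ≤ 4 * ((iarea c.1 rest : ℚ) : ℝ) := by
        have : (0 : ℝ) ≤ ((iarea c.1 rest : ℚ) : ℝ) := by exact_mod_cast hA
        positivity
      rw [← ENNReal.ofReal_add ha hb]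
      push_cast
      ring_nf
    · show (0 : ℚ) ≤ (c.1 - xp) * c.2 + iarea c.1 rest
      have : (0 : ℚ) ≤ c.2 := by exact_mod_cast hy0.le
      nlinarith

/-- **INNER soundness**: an accepted inscribed staircase gives `2·area/π² ≤ n[ε_{t′}](μ)`. [folklore] -/
theorem IStair.filling_ge (C : IStair) (h : C.check = true) :
    2 * ((C.area : ℚ) : ℝ) / π ^ 2 ≤ KohnLuttinger.filling (squareDispersion 1 (C.tp : ℝ)) (C.mu : ℝ) := by
  obtain ⟨tp, mu, cs⟩ := C
  simp only [IStair.check, Bool.and_eq_true, decide_eq_true_eq] at h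
  obtain ⟨⟨ht1, ht2⟩, hchain⟩ := h
  have htp : |((tp : ℚ) : ℝ)| ≤ 1 / 2 := by
    have h1 : (((-(1 / 2) : ℚ)) : ℝ) ≤ ((tp : ℚ) : ℝ) := by exact_mod_cast ht1
    have h2 : ((tp : ℚ) : ℝ) ≤ (((1 / 2 : ℚ)) : ℝ) := by exact_mod_cast ht2
    push_cast at h1 h2
    exact abs_le.2 ⟨h1, h2⟩
  obtain ⟨hR, -, -, hV, hA⟩ := istair_spec htp cs 0 le_rfl hchain
  have h1 : ENNReal.ofReal (4 * ((iarea 0 cs : ℚ) : ℝ)) ≤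
      volume ({p : Momentum | squareDispersion 1 (tp : ℝ) p < mu} ∩ brillouinZone) := by
    rw [← hV, volume_sea_eq]; exact measure_mono hR
  have h2 : 4 * ((iarea 0 cs : ℚ) : ℝ) ≤
      (volume ({p : Momentum | squareDispersion 1 (tp : ℝ) p < mu} ∩ brillouinZone)).toReal :=
    (ENNReal.ofReal_le_iff_le_toReal (volume_sea_lt_top _ _).ne).1 h1
  show 2 * ((iarea 0 cs : ℚ) : ℝ) / π ^ 2 ≤ KohnLuttinger.filling (squareDispersion 1 (tp : ℝ)) (mu : ℝ)
  rw [filling_eq_volume]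
  have hpi : 0 < π := Real.pi_pos
  rw [div_le_div_iff₀ (by positivity) (by positivity)]
  nlinarith

/-- **Certified lower filling bound** from an INNER certificate and a decided rational inequality `r·3.141593² ≤ 2·area`. [folklore] -/
theorem IStair.le_filling (C : IStair) (r : ℚ) (h : C.check = true) (hr : r * piUpQ ^ 2 ≤ 2 * C.area) :
    ((r : ℚ) : ℝ) ≤ KohnLuttinger.filling (squareDispersion 1 (C.tp : ℝ)) (C.mu : ℝ) := by
  rcases lt_or_ge ((r : ℚ) : ℝ) 0 with hneg | hr0
  · exact le_trans hneg.le (filling_nonneg 1 _ _)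
  · refine le_trans ?_ (C.filling_ge h)
    have hr' : ((r : ℚ) : ℝ) * ((piUpQ : ℚ) : ℝ) ^ 2 ≤ 2 * ((C.area : ℚ) : ℝ) := by exact_mod_cast hr
    have hup := pi_lt_piUpQ
    have hpi : 0 < π := Real.pi_pos
    rw [le_div_iff₀ (by positivity)]
    have hle : ((r : ℚ) : ℝ) * π ^ 2 ≤ ((r : ℚ) : ℝ) * ((piUpQ : ℚ) : ℝ) ^ 2 :=
      mul_le_mul_of_nonneg_left (by nlinarith) hr0
    linarith

/-! ### §5  OUTER soundness: the sea lies in the staircase; `n ≤ 2·area/π²` -/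

/-- The OUTER staircase from corner `c` on, as a set (last column to `3.141593`). [folklore] -/
def ocoverSet : ℚ × ℚ → List (ℚ × ℚ) → Set (ℝ × ℝ)
  | c, [] => absBox (c.1 : ℝ) ((piUpQ : ℚ) : ℝ) (c.2 : ℝ)
  | c, c' :: rest => absBox (c.1 : ℝ) (c'.1 : ℝ) (c.2 : ℝ) ∪ ocoverSet c' rest

/-- A certified OUTER corner `(u, v)` bounds the sea column over `{u ≤ |q₀|}` in height: `|q₁| < v`. [folklore] -/
theorem snd_lt_of_ocorner {tp mu : ℚ} (htp : |(tp : ℝ)| ≤ 1 / 2) {c : ℚ × ℚ} (hc : ocornerOK tp mu c = true)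
    {q : ℝ × ℝ} (hq : q ∈ seaCoord tp mu) (hu : ((c.1 : ℚ) : ℝ) ≤ |q.1|) : |q.2| < ((c.2 : ℚ) : ℝ) := by
  obtain ⟨hu0, hv0, hcase⟩ := ocorner_sound htp hc
  obtain ⟨hq1, hq2⟩ := abs_le_pi_of_mem_seaCoord hq
  rcases hcase with hfull | hband
  · exact lt_of_le_of_lt hq2 hfull
  · by_contra hle
    push Not at hle
    have hmono := bandR_cos_mono htp hu0 hu hq1 hv0 hle hq2
    rw [Real.cos_abs, Real.cos_abs] at hmono
    have hlt : bandR tp (cos q.1) (cos q.2) < mu := hq.2.2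
    linarith

/-- A circumscribed staircase passing `ochain` covers `seaCoord` (restricted to `|x| ≥` the current abscissa) with volume at most `4·oarea` (induction on the chain). [folklore] -/
theorem ocover_spec {tp mu : ℚ} (htp : |(tp : ℝ)| ≤ 1 / 2) :
    ∀ (rest : List (ℚ × ℚ)) (c : ℚ × ℚ), ochain tp mu c rest = true →
      seaCoord tp mu ∩ {q : ℝ × ℝ | ((c.1 : ℚ) : ℝ) ≤ |q.1|} ⊆ ocoverSet c rest ∧
        volume (ocoverSet c rest) ≤ ENNReal.ofReal (4 * ((oarea c rest : ℚ) : ℝ)) ∧ (0 : ℚ) ≤ oarea c rest := by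
  intro rest
  induction rest with
  | nil =>
    intro c h
    simp only [ochain, Bool.and_eq_true, decide_eq_true_eq] at h
    obtain ⟨hc, hcu⟩ := h
    obtain ⟨hu0, hv0, -⟩ := ocorner_sound htp hc
    have hcu' : ((c.1 : ℚ) : ℝ) ≤ ((piUpQ : ℚ) : ℝ) := by exact_mod_cast hcu
    refine ⟨?_, ?_, ?_⟩
    · rintro q ⟨hq, hu⟩
      simp only [mem_setOf_eq] at hu
      refine mem_absBox.2 ⟨hu, ?_, snd_lt_of_ocorner htp hc hq hu⟩
      exact lt_of_le_of_lt (abs_le_pi_of_mem_seaCoord hq).1 pi_lt_piUpQ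
    · show volume (absBox (c.1 : ℝ) ((piUpQ : ℚ) : ℝ) (c.2 : ℝ)) ≤ ENNReal.ofReal (4 * ((((piUpQ - c.1) * c.2 : ℚ)) : ℝ))
      rw [volume_absBox hu0 hcu']; push_cast; exact le_rfl
    · show (0 : ℚ) ≤ (piUpQ - c.1) * c.2
      have : (0 : ℚ) ≤ c.2 := by exact_mod_cast hv0
      nlinarith
  | cons c' rest ih =>
    intro c h
    simp only [ochain, Bool.and_eq_true, decide_eq_true_eq] at h
    obtain ⟨⟨hc, hcc'⟩, hrest⟩ := h
    obtain ⟨hu0, hv0, -⟩ := ocorner_sound htp hc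
    obtain ⟨hR, hV, hA⟩ := ih c' hrest
    have hcc'' : ((c.1 : ℚ) : ℝ) ≤ ((c'.1 : ℚ) : ℝ) := by exact_mod_cast hcc'
    refine ⟨?_, ?_, ?_⟩
    · rintro q ⟨hq, hu⟩
      simp only [mem_setOf_eq] at hu
      by_cases hlt : |q.1| < ((c'.1 : ℚ) : ℝ)
      · exact Or.inl (mem_absBox.2 ⟨hu, hlt, snd_lt_of_ocorner htp hc hq hu⟩)
      · exact Or.inr (hR ⟨hq, le_of_not_gt hlt⟩)
    · show volume (absBox (c.1 : ℝ) (c'.1 : ℝ) (c.2 : ℝ) ∪ ocoverSet c' rest) ≤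
        ENNReal.ofReal (4 * ((((c'.1 - c.1) * c.2 + oarea c' rest : ℚ)) : ℝ))
      refine (measure_union_le _ _).trans ?_
      have ha : (0 : ℝ) ≤ 4 * ((((c'.1 : ℚ) : ℝ) - c.1) * c.2) := by
        have : (0 : ℝ) ≤ (((c'.1 : ℚ) : ℝ) - c.1) := by linarith
        positivity
      have hb : (0 : ℝ) ≤ 4 * ((oarea c' rest : ℚ) : ℝ) := by
        have : (0 : ℝ) ≤ ((oarea c' rest : ℚ) : ℝ) := by exact_mod_cast hA
        positivity
      calc volume (absBox (c.1 : ℝ) (c'.1 : ℝ) (c.2 : ℝ)) + volume (ocoverSet c' rest)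
          ≤ ENNReal.ofReal (4 * ((((c'.1 : ℚ) : ℝ) - c.1) * c.2)) + ENNReal.ofReal (4 * ((oarea c' rest : ℚ) : ℝ)) :=
            add_le_add (le_of_eq (volume_absBox hu0 hcc'')) hV
        _ = ENNReal.ofReal (4 * ((((c'.1 - c.1) * c.2 + oarea c' rest : ℚ)) : ℝ)) := by
            rw [← ENNReal.ofReal_add ha hb]; push_cast; ring_nf
    · show (0 : ℚ) ≤ (c'.1 - c.1) * c.2 + oarea c' rest
      have : (0 : ℚ) ≤ c.2 := by exact_mod_cast hv0
      nlinarith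

/-- **OUTER soundness**: an accepted circumscribed staircase gives `n[ε_{t′}](μ) ≤ 2·area/π²`. [folklore] -/
theorem OStair.filling_le (C : OStair) (h : C.check = true) :
    KohnLuttinger.filling (squareDispersion 1 (C.tp : ℝ)) (C.mu : ℝ) ≤ 2 * ((C.area : ℚ) : ℝ) / π ^ 2 := by
  obtain ⟨tp, mu, cs⟩ := C
  simp only [OStair.check, Bool.and_eq_true, decide_eq_true_eq] at h
  obtain ⟨⟨ht1, ht2⟩, hchain⟩ := h
  have htp : |((tp : ℚ) : ℝ)| ≤ 1 / 2 := by
    have h1 : (((-(1 / 2) : ℚ)) : ℝ) ≤ ((tp : ℚ) : ℝ) := by exact_mod_cast ht1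
    have h2 : ((tp : ℚ) : ℝ) ≤ (((1 / 2 : ℚ)) : ℝ) := by exact_mod_cast ht2
    push_cast at h1 h2
    exact abs_le.2 ⟨h1, h2⟩
  cases cs with
  | nil => simp at hchain
  | cons c rest =>
    simp only [Bool.and_eq_true, decide_eq_true_eq] at hchain
    obtain ⟨hc0, hchain⟩ := hchain
    obtain ⟨hR, hV, hA⟩ := ocover_spec htp rest c hchain
    have hsub : seaCoord tp mu ⊆ ocoverSet c rest := by
      intro q hq
      exact hR ⟨hq, by simp only [mem_setOf_eq, hc0]; push_cast; exact abs_nonneg _⟩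
    have h1 : volume ({p : Momentum | squareDispersion 1 (tp : ℝ) p < mu} ∩ brillouinZone) ≤
        ENNReal.ofReal (4 * ((oarea c rest : ℚ) : ℝ)) := by
      rw [volume_sea_eq]; exact (measure_mono hsub).trans hV
    have hA' : (0 : ℝ) ≤ 4 * ((oarea c rest : ℚ) : ℝ) := by
      have : (0 : ℝ) ≤ ((oarea c rest : ℚ) : ℝ) := by exact_mod_cast hA
      positivity
    have h2 := ENNReal.toReal_le_of_le_ofReal hA' h1
    show KohnLuttinger.filling (squareDispersion 1 (tp : ℝ)) (mu : ℝ) ≤ 2 * ((oarea c rest : ℚ) : ℝ) / π ^ 2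
    rw [filling_eq_volume]
    have hpi : 0 < π := Real.pi_pos
    rw [div_le_div_iff₀ (by positivity) (by positivity)]
    nlinarith

/-- **Certified strict upper filling bound** from an OUTER certificate and a decided rational inequality `2·area < r·3.141592²`. [folklore] -/
theorem OStair.filling_lt (C : OStair) (r : ℚ) (h : C.check = true) (hr : 2 * C.area < r * piLoQ ^ 2) :
    KohnLuttinger.filling (squareDispersion 1 (C.tp : ℝ)) (C.mu : ℝ) < ((r : ℚ) : ℝ) := by
  refine lt_of_le_of_lt (C.filling_le h) ?_
  have hr' : 2 * ((C.area : ℚ) : ℝ) < ((r : ℚ) : ℝ) * ((piLoQ : ℚ) : ℝ) ^ 2 := by exact_mod_cast hr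
  have hlo : ((piLoQ : ℚ) : ℝ) < π := by rw [FSPoly.piLoQ]; push_cast; linarith [Real.pi_gt_d6]
  have hlo0 : (0 : ℝ) < ((piLoQ : ℚ) : ℝ) := by rw [FSPoly.piLoQ]; push_cast; norm_num
  have hpi : 0 < π := Real.pi_pos
  have hA : (0 : ℝ) ≤ 2 * ((C.area : ℚ) : ℝ) := by
    have := C.filling_le h
    have hn := filling_nonneg 1 (C.tp : ℝ) (C.mu : ℝ)
    have : (0 : ℝ) ≤ 2 * ((C.area : ℚ) : ℝ) / π ^ 2 := le_trans hn this
    have hp2 : (0 : ℝ) < π ^ 2 := by positivity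
    exact (div_nonneg_iff.1 this).elim (fun h => h.1) (fun h => absurd h.2 (not_le.2 hp2))
  have hr0 : (0 : ℝ) < ((r : ℚ) : ℝ) := by
    by_contra hle; push Not at hle
    have : ((r : ℚ) : ℝ) * ((piLoQ : ℚ) : ℝ) ^ 2 ≤ 0 := mul_nonpos_of_nonpos_of_nonneg hle (by positivity)
    linarith
  rw [div_lt_iff₀ (by positivity)]
  calc 2 * ((C.area : ℚ) : ℝ) < ((r : ℚ) : ℝ) * ((piLoQ : ℚ) : ℝ) ^ 2 := hr'
    _ ≤ ((r : ℚ) : ℝ) * π ^ 2 := mul_le_mul_of_nonneg_left (by nlinarith) hr0.le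

/-! ### §6  From certified fillings to the chemical potential `μ(δ; t′)` and the VH-referenced level `d̃(δ; t′)` -/

/-- `1 − δ ≤ n(μ₀)` puts `μ₀` in the superlevel set, so `μ(δ; t′) ≤ μ₀`. [folklore] -/
theorem muOfDoping_le_of_le_filling {tp δ μ₀ : ℝ} (hδ : δ < 1)
    (h : 1 - δ ≤ KohnLuttinger.filling (squareDispersion 1 tp) μ₀) : klMuOfDopingTP tp δ ≤ μ₀ := by
  unfold klMuOfDopingTP chemicalPotentialOfDensity
  exact csInf_le (fillingSet_bddBelow tp (by linarith)) h

/-- `n(μ₀) < 1 − δ` makes `μ₀` a lower bound of the superlevel set (the filling is monotone), so `μ₀ ≤ μ(δ; t′)`. [folklore] -/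
theorem le_muOfDoping_of_filling_lt {tp δ μ₀ : ℝ} (hδ : -1 ≤ δ)
    (h : KohnLuttinger.filling (squareDispersion 1 tp) μ₀ < 1 - δ) : μ₀ ≤ klMuOfDopingTP tp δ := by
  unfold klMuOfDopingTP chemicalPotentialOfDensity
  refine le_csInf (fillingSet_nonempty tp (by linarith)) fun m hm => ?_
  by_contra hlt
  push Not at hlt
  have hmono := filling_monotone 1 tp hlt.le
  simp only [mem_setOf_eq] at hm
  linarith


end Summit.HubbardSuperconductivity.HubbardSuperconductivity.Theorems.KlStair
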